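import Mathlib
import Literature.Probability.LatticeModels.ScalingLimit
import Summits.CriticalPhenomena.Ising3DConformalLimit.Theorems.PrimaryAtInfinityWardToMoebiusWeakTransl
import HarnessLib

/-!
# Strong translation invariance implies the weak translation identity

Support file for the crux `MoebiusLimitExists` (item stmt-CriticalPhenomena-1344, route PlantedPinning,
line `Sketch` v9 "Ward door"): stub F0 `stub_weakTranslation` of the skeleton
`MoebiusLimitExistsSketchV9` — the translation part of the textbook converse "finite conformal
covariance ⇒ weak Ward identity".

Let `U` be an open subset of a real normed space `W` carrying an additive Haar measure `μ`
(e.g. a finite-dimensional space with Lebesgue measure), let `F : W → ℝ` be continuous on `U`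
(arbitrary, possibly non-measurable, elsewhere) and invariant under the translation flow of a
vector `c`, `F (z + s • c) = F z` for all `s : ℝ` and `z : W`.  Then the WEAK translation identity `∫ F · ∂_c φ dμ = 0` holds for every smooth `φ`
compactly supported in `U` (`integral_mul_fderiv_eq_zero_of_forall_add_smul_eq`).  Proof: the
pairing `g(s) := ∫ F(z) φ(z − s c) dμ(z)` is constant in `s` (substitute `z = y + s c` and use the
invariance of `μ` and of `F`), while differentiation under the integral sign
(`hasDerivAt_integral_of_dominated_loc_of_deriv_le`, on the compact set swept by a small closed
thickening of `tsupport φ` inside `U`, on which `F` is bounded) gives `g′(0) = −∫ F ∂_c φ dμ`;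
hence the latter vanishes.

Specialised to configuration space `(ℝ³)ⁿ = Fin n → EuclideanSpace ℝ (Fin 3)` with product Lebesgue
measure, `U = NonCoincident 3 n` (pairwise distinct configurations) and the diagonal direction
`c = (v, …, v)`, this is `stub_weakTranslation`: a function continuous off the diagonals and
invariant under diagonal translations satisfies `∫ F(x) Dφ(x)[(v, …, v)] dx = 0` for all smooth `φ`
compactly supported off the diagonals.

References: folklore distribution theory (the distributional derivative of a translation-invariant
locally integrable function along the direction of invariance vanishes; cf. Hörmander, *The
Analysis of Linear Partial Differential Operators I*, Thm 3.1.4' for the converse); Di Francesco–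
Mathieu–Sénéchal, *Conformal Field Theory*, §4.3.1 (Ward identities from covariance).  The analytic
set-up (tube, domination, helpers `continuous_mul_of_tsupport_subset`, `tsupport_comp_sub`,
`hasCompactSupport_comp_sub`) is that of `apply_add_eq_of_weak_translation_invariant` in
`PrimaryAtInfinityWardToMoebiusWeakTransl`.  No definitions are introduced.
-/

noncomputable section

open Filter Topology MeasureTheory Set Metric
open Literature.Probability.LatticeModels
open Summit.CriticalPhenomena.Ising3DConformalLimit.WardToMoebius

namespace Summit.CriticalPhenomena.Ising3DConformalLimit.MoebiusLimitExistsSketchV9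

section General

variable {W : Type*} [NormedAddCommGroup W] [NormedSpace ℝ W]
  [MeasurableSpace W] [BorelSpace W] (μ : Measure W) [μ.IsAddHaarMeasure]

/-- **Strong translation invariance along a direction implies the weak translation identity.**
Let `U ⊆ W` be open, `F` continuous on `U` and invariant under the flow `z ↦ z + s • c`
(`F (z + s • c) = F z` for all real `s` and all `z`). Then `∫ F · ∂_c φ dμ = 0` for every smooth
`φ` compactly supported in `U`: the pairing `s ↦ ∫ F(z) φ(z - s • c) dμ` is constant (Haar
invariance and invariance of `F`) and its derivative at `0`, computed under the integral sign, is
`-∫ F ∂_c φ dμ`. [folklore] -/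
theorem integral_mul_fderiv_eq_zero_of_forall_add_smul_eq
    {U : Set W} (hU : IsOpen U) {F : W → ℝ} (hF : ContinuousOn F U) {c : W}
    (hinv : ∀ (s : ℝ) (z : W), F (z + s • c) = F z)
    {φ : W → ℝ} (hφ : ContDiff ℝ (⊤ : ℕ∞) φ) (hφc : HasCompactSupport φ)
    (hφU : tsupport φ ⊆ U) :
    ∫ z, F z * fderiv ℝ φ z c ∂μ = 0 := by
  /- Step 1: the pairing `s ↦ ∫ F(z) φ(z - s • c)` is constant. -/
  have hconst : ∀ s : ℝ, ∫ z, F z * φ (z - s • c) ∂μ = ∫ z, F z * φ z ∂μ := by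
    intro s
    rw [← integral_add_right_eq_self (μ := μ) (fun z => F z * φ (z - s • c)) (s • c)]
    simp only [add_sub_cancel_right, hinv]
  /- Step 2: a margin `δ'`: translates of `tsupport φ` by `s • c`, `|s| ≤ δ'`, stay in `U`. -/
  obtain ⟨δ, hδ, hthick⟩ := hφc.isCompact.exists_cthickening_subset_open hU hφU
  obtain ⟨δ', hδ', hδ'c⟩ : ∃ δ' : ℝ, 0 < δ' ∧ δ' * ‖c‖ ≤ δ := by
    refine ⟨δ / (‖c‖ + 1), by positivity, ?_⟩
    rw [div_mul_eq_mul_div, div_le_iff₀ (by positivity)]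
    nlinarith [norm_nonneg c]
  set R : Set ℝ := Icc (-δ') δ'
  have hRc : IsCompact R := isCompact_Icc
  have h0R : (0 : ℝ) ∈ R := ⟨by linarith, hδ'.le⟩
  have hballR : ball (0 : ℝ) δ' ⊆ R := by
    intro s hs
    rw [mem_ball, dist_zero_right, Real.norm_eq_abs] at hs
    exact ⟨(abs_lt.1 hs).1.le, (abs_lt.1 hs).2.le⟩
  have hflow : ∀ y ∈ tsupport φ, ∀ s ∈ R, y + s • c ∈ U := by
    intro y hy s hs
    refine hthick (mem_cthickening_of_dist_le (y + s • c) y δ (tsupport φ) hy ?_)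
    rw [dist_eq_norm, add_sub_cancel_left, norm_smul, Real.norm_eq_abs]
    have hs' : |s| ≤ δ' := abs_le.2 ⟨hs.1, hs.2⟩
    calc |s| * ‖c‖ ≤ δ' * ‖c‖ := by gcongr
      _ ≤ δ := hδ'c
  -- translates by `s ∈ R` are supported in `U`
  have hsuppR : ∀ s ∈ R, tsupport (fun z => φ (z - s • c)) ⊆ U := by
    intro s hs z hz
    rw [tsupport_comp_sub] at hz
    have := hflow _ hz s hs
    simpa using this
  /- Step 3: the compact set swept by the support, bounds, the family and its derivative. -/
  set K' : Set W := (fun p : W × ℝ => p.1 + p.2 • c) '' (tsupport φ ×ˢ R)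
  have hK'c : IsCompact K' := (hφc.prod hRc).image (by fun_prop)
  have hK'U : K' ⊆ U := by
    rintro _ ⟨⟨y, s⟩, ⟨hy, hs⟩, rfl⟩
    exact hflow y hy s hs
  obtain ⟨M₀, hM₀⟩ := hK'c.exists_bound_of_continuousOn (hF.mono hK'U)
  obtain ⟨C₀, hC₀⟩ := (hφ.continuous_fderiv (by simp)).bounded_above_of_compact_support
    (hφc.fderiv (𝕜 := ℝ))
  set M : ℝ := max M₀ 0
  set C : ℝ := max C₀ 0
  have hM : ∀ z ∈ K', ‖F z‖ ≤ M := fun z hz => (hM₀ z hz).trans (le_max_left _ _)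
  have hC : ∀ y, ‖fderiv ℝ φ y‖ ≤ C := fun y => (hC₀ y).trans (le_max_left _ _)
  have hM0 : 0 ≤ M := le_max_right _ _
  have hC0 : 0 ≤ C := le_max_right _ _
  set G : ℝ → W → ℝ := fun s z => F z * φ (z - s • c) with hG
  set G' : ℝ → W → ℝ := fun s z => F z * (fderiv ℝ φ (z - s • c)) (-c) with hG'
  have hGcont : ∀ s ∈ R, Continuous (G s) := fun s hs =>
    continuous_mul_of_tsupport_subset hU hF (hφ.continuous.comp (by fun_prop)) (hsuppR s hs)
  have hG'cont : ∀ s ∈ R, Continuous (G' s) := by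
    intro s hs
    refine continuous_mul_of_tsupport_subset hU hF ?_ ?_
    · exact ((hφ.continuous_fderiv (by simp)).comp (by fun_prop)).clm_apply continuous_const
    · refine Subset.trans ?_ (hsuppR s hs)
      refine closure_minimal ?_ (isClosed_tsupport _)
      intro z hz
      rw [tsupport_comp_sub]
      by_contra hz'
      apply hz
      simp [fderiv_of_notMem_tsupport (𝕜 := ℝ) hz']
  have hdiff : ∀ z s, HasDerivAt (fun s => G s z) (G' s z) s := by
    intro z s
    have h1 : HasDerivAt (fun s : ℝ => z - s • c) (-c) s := by
      simpa using ((hasDerivAt_id s).smul_const c).const_sub z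
    have h2 : HasDerivAt (fun s : ℝ => φ (z - s • c)) (fderiv ℝ φ (z - s • c) (-c)) s :=
      (hφ.differentiable (by simp) _).hasFDerivAt.comp_hasDerivAt s h1
    exact h2.const_mul (F z)
  -- bound on the derivative, supported in `K'`
  have hbound : ∀ z, ∀ s ∈ R, ‖G' s z‖ ≤ K'.indicator (fun _ => M * (C * ‖c‖)) z := by
    intro z s hs
    by_cases hzs : z - s • c ∈ tsupport φ
    · have hzK' : z ∈ K' := ⟨(z - s • c, s), ⟨hzs, hs⟩, by simp⟩
      rw [indicator_of_mem hzK', hG', norm_mul]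
      refine mul_le_mul (hM z hzK') ?_ (norm_nonneg _) hM0
      exact (ContinuousLinearMap.le_opNorm _ _).trans
        (by rw [norm_neg]; exact mul_le_mul_of_nonneg_right (hC _) (norm_nonneg _))
    · have : G' s z = 0 := by simp [hG', fderiv_of_notMem_tsupport (𝕜 := ℝ) hzs]
      rw [this, norm_zero]
      exact indicator_nonneg (fun _ _ => by positivity) z
  have hbound_int : Integrable (K'.indicator fun _ => M * (C * ‖c‖)) μ :=
    (integrable_indicator_iff hK'c.measurableSet).2
      (integrableOn_const (hK'c.measure_lt_top (μ := μ)).ne)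
  /- Step 4: differentiate the constant pairing at `s = 0` under the integral sign. -/
  have key := hasDerivAt_integral_of_dominated_loc_of_deriv_le (μ := μ) (F := G) (F' := G')
    (x₀ := 0) (bound := K'.indicator fun _ => M * (C * ‖c‖)) (ball_mem_nhds 0 hδ')
    (Filter.eventually_of_mem (ball_mem_nhds 0 hδ')
      fun s hs => (hGcont s (hballR hs)).aestronglyMeasurable)
    ((hGcont 0 h0R).integrable_of_hasCompactSupport
      ((hasCompactSupport_comp_sub hφc ((0 : ℝ) • c)).mul_left))
    (hG'cont 0 h0R).aestronglyMeasurable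
    (Filter.Eventually.of_forall fun z s hs => hbound z s (hballR hs))
    hbound_int
    (Filter.Eventually.of_forall fun z s _ => hdiff z s)
  have hg : (fun s => ∫ z, G s z ∂μ) = fun _ => ∫ z, F z * φ z ∂μ := by
    funext s
    simp only [hG]
    exact hconst s
  have hzero : ∫ z, G' 0 z ∂μ = 0 := by
    have h1 := key.2
    rw [hg] at h1
    exact h1.unique (hasDerivAt_const _ _)
  have h2 : ∫ z, G' 0 z ∂μ = -∫ z, F z * fderiv ℝ φ z c ∂μ := by
    simp only [hG', zero_smul, sub_zero, map_neg, mul_neg, integral_neg]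
  linarith

end General

/-- **STUB F0 of line `Sketch` v9 — `stub_weakTranslation`.**  A function on configuration space
`(ℝ³)ⁿ` that is continuous off the diagonals (on `NonCoincident 3 n`, arbitrary elsewhere) and
invariant under the diagonal translations `x ↦ (xᵢ + v)ᵢ` satisfies the WEAK translation identity
`∫ F(x) Dφ(x)[(v, …, v)] dx = 0` for every smooth `φ` compactly supported off the diagonals
(`integral_mul_fderiv_eq_zero_of_forall_add_smul_eq` on `W = Fin n → ℝ³` with product Lebesgue
measure, `U = NonCoincident 3 n`, `c = (v, …, v)`). [folklore] -/
theorem stub_weakTranslation :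
    ∀ (n : ℕ) (F : (Fin n → EuclideanSpace ℝ (Fin 3)) → ℝ),
      ContinuousOn F (NonCoincident 3 n) →
      (∀ (v : EuclideanSpace ℝ (Fin 3)) (x : Fin n → EuclideanSpace ℝ (Fin 3)), F (fun i => x i + v) = F x) →
      ∀ (v : EuclideanSpace ℝ (Fin 3)) (φ : (Fin n → EuclideanSpace ℝ (Fin 3)) → ℝ),
        ContDiff ℝ ((⊤ : ℕ∞) : WithTop ℕ∞) φ → HasCompactSupport φ → tsupport φ ⊆ NonCoincident 3 n →
        ∫ x, F x * fderiv ℝ φ x (fun _ => v) = 0 := by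
  intro n F hF htr v φ hφ hφc hφU
  refine integral_mul_fderiv_eq_zero_of_forall_add_smul_eq volume (isOpen_nonCoincident 3 n) hF
    (c := fun _ => v) (fun s x => ?_) hφ hφc hφU
  exact htr (s • v) x

end Summit.CriticalPhenomena.Ising3DConformalLimit.MoebiusLimitExistsSketchV9

end
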